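import Summits.BirchSwinnertonDyer.Rank1Residual.Additive.WildThreeQuaternionicTransfer
import Literature.NumberTheory.Automorphic.ShimuraCurveRibetTakahashiExactProofs
import HarnessLib

/-!
# R5a of T-O6-R5 in the kernel: `QuaternionicTamagawaTransferAtThreeKnownCase` DERIVED from the
# Ribet–Takahashi inputs at `ℓ = 3` (ASK A-O6-J8b of o6-r2 GEN 5; cell `b2b-bsdres`, lane
# CLASS-CLOSURE, class O6; cc-typer-5 GEN 4 — THEOREMS ONLY, 0 definitions, 0 named facts)

HONEST FRAMING (cell `b2b-bsdres`, verbatim in every file): the goal of the cell is to DELETE the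
COMBINATION-SHAPED residual classes of the Birch–Swinnerton-Dyer formula for ALL analytic-rank `≤ 1`
elliptic curves over `ℚ` — "full BSD formula for every rank `≤ 1` curve in class `C`" assembled
STRICTLY from published theorems — so that the rank-`≤ 1` remainder becomes exactly the
CONSTRUCTION-SHAPED classes, which are TYPED (missing-input `Prop`s), NOT attempted. This is not
"finishing BSD". Lane CLASS-CLOSURE: research routes; no claim beyond the stated classes; nothing is
booked and no mark of `RESIDUAL-MAP.md` moves. This file mints NO fact and NO definition: it DERIVES
the typed proved-case node `AdditiveThree.QuaternionicTamagawaTransferAtThreeKnownCase`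
(`Additive/WildThreeQuaternionicTransfer.lean`, o6-r2 GEN 5, "R5a = theorem-chain in print") from the
printed Ribet–Takahashi inputs carried AS HYPOTHESES, in the idiom of the tree's
`Literature.NumberTheory.Automorphic.PastenShimura2024_thm_6_1_b'` (Pasten 2024 §6 performed over
section variables `cI`, `cJ` with `h613`, `hJc`, `hEis`, …). The mathematics — Pasten §6.9 performed
EXACTLY at a prime `ℓ` with `E[ℓ]` irreducible — is the Literature `Proofs` file
`ShimuraCurveRibetTakahashiExactProofs.lean` (`modularDegree_mul_eq_mul_coprime_of_witness`); this
file is its instance `ℓ = 3` read into the O6 node.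

## What is proved
`quaternionicTamagawaTransferAtThreeKnownCase_of_ribetTakahashi_inputs`: from
* `hP` — the Jacquet–Langlands existence fact `nonempty_shimuraParametrizationData` (a binder, as in
  every Ribet–Takahashi theorem of the tree);
* `cI`, `cJ`, `hI`, `hJ` — the component-group data `i_p(D,M)`, `j_p(D,M)` (orders of image and
  cokernel of `q_{D,M,p,*}` on `Φ_p`, §6.6 p. 23) of the class-minimal datum, positive;
* `h613` — Prop. 6.13 p. 23 = Ribet–Takahashi 1997 Thm. 2 (`M` need not be squarefree);
* `hJc` — `j_p(D,M) ∣ #Φ_p(A_{D,M}) = c_p(A_{D,M})` (§6.6);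
* `hEis` — Ribet's Eisenstein divisibility `i_p(D,M) ∣ r + 1 − a_r(A_{D,M})` for `p ∥ M`, `r ∤ N`
  (the proof of Lemma 6.14 p. 23);
* `h618` — Lemma 6.18 p. 25 (Papikian–Rabinoff): `j_p(D,M) ∣ p − 1` for `p ∣ D`;
* `hwit` — an IRREDUCIBILITY WITNESS: `W[3]` irreducible ⇒ arbitrarily large primes `r` with
  `3 ∤ r + 1 − a_r(W)` (Chebotarev + Brauer–Nesbitt: otherwise `ρ̄_{W,3}^{ss} ≅ 1 ⊕ ω`; the per-curve
  `β = 1` case of the mechanism of Lemma 6.7 p. 22);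
* `h0'` — the `3`-adic `D = 1` BRIDGE between the tree's two renderings of `δ_{1,N}` (class-minimal
  Shimura datum on a `ShimuraCurveData 1 N` vs. the minimal classical datum carrying the newform):
  they differ by a `3`-unit factor (Pasten has one number `δ_{1,N}`; the tree's Thm. 6.1 (b) carries
  the divisibility form `h0 : P.deg ∣ D₁.modularDegree`),
the statement `QuaternionicTamagawaTransferAtThreeKnownCase`: for `N = D M` admissible with a prime
`q₀ ∣ D` such that `q₀ ≢ 1 (mod 3)`, or such that `3 ∤ v_{q₀}(Δ_E)` for the curves `E` of conductor
`N`, and `E[3]` irreducible, `γ_{D,M,E} = (δ_{1,N}/δ_{D,M}) / ∏_{q∣D} v_q(Δ_E)` is a `3`-adic unit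
(`RTGammaThreeUnitAt W D₁ P`). Axioms: `propext`, `Classical.choice`, `Quot.sound`.

## How (summary of the Literature file)
Lemma 6.8 is EXACT at `3` when `E[3]` is irreducible (a THEOREM, no Mazur–Kenku: a cyclic isogeny of
the class has degree prime to `3`, else `ker ∩ E[3]` is a rational `3`-isogeny kernel); hence Lemma
6.15 is EXACT (`v₃ j_p(D,M) = v₃ j_r(D,M)`); `3 ∤ i_p` by `hEis` at a witness prime; `3 ∤ j_{q₀}` by
`h618` or `hJc`; and the telescoping of §6.9 KEEPS THE WITNESS PRIME `q₀` IN `D` UNTIL THE LAST PAIR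
(o6-r2's sketch put `q₀` in the first pair; the induction hypothesis needs the witness at every
smaller `D`, so at `ω(D) ≥ 4` the removed pair avoids `q₀` and inherits `3 ∤ j_r(D,M)` from
`j_{q₀}(D,M)` by exact switching; at `ω(D) = 2` the pair is `(p, q₀)` and the base `D = 1` is `h0'`).

## What is NOT proved (status of R5a after this file)
R5a is a THEOREM-CHAIN over the printed inputs listed above, now kernel-checked AS A CHAIN; the
remaining trust base is exactly `hP`, `h613`, `hJc`, `hEis`, `h618`, `hwit`, `h0'` — printed theorems
(Jacquet–Langlands; Ribet–Takahashi 1997 Thm. 2 / Pasten Prop. 6.13; §6.6; Ribet's Eisenstein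
argument; Papikian–Rabinoff; Chebotarev–Brauer–Nesbitt) and one bookkeeping bridge, none a declaration
of the tree — the SAME epistemic status as `PastenShimura2024_thm_6_1_b'`. R5b (all primes of `D`
`≡ 1 (mod 3)` with `3 ∣ v_q(Δ)`, no witness) is untouched and stays inside the typed OPEN node
`QuaternionicTamagawaTransferAtThree`; Nekovář₃^D, GZ^D, Manin₃^D and T-O6-J^D of the R-O6-5 road
(o6-r2 GEN 5 (G5-6)) are untouched. Nothing is booked; no mark moves; R-O6-5′ unchanged.
References: [PastenShimura2024] §6 (Prop. 6.13, Lemmas 6.8, 6.14, 6.15, 6.18, §6.9);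
[RibetTakahashi1997] Thm. 2; [Mazur1978] Thm. 1.
-/

set_option autoImplicit false

noncomputable section

open scoped Classical

namespace Summit.BirchSwinnertonDyer.Rank1Residual.AdditiveThree

open Literature.NumberTheory.Automorphic
open Literature.NumberTheory.EllipticCurves.ModularForms (ModularParametrizationData IsNewformOf)
open WeierstrassCurve

section RTSystemAtThree

variable (cI cJ : ∀ {D M : ℕ} {X : ShimuraCurveData D M} {W' : WeierstrassCurve ℚ},
    ShimuraParametrizationData X W' → ℕ → ℕ)
  (hI : ∀ {D M : ℕ} {X : ShimuraCurveData D M} {W' : WeierstrassCurve ℚ}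
    (P : ShimuraParametrizationData X W') (p : ℕ), 0 < cI P p)
  (hJ : ∀ {D M : ℕ} {X : ShimuraCurveData D M} {W' : WeierstrassCurve ℚ}
    (P : ShimuraParametrizationData X W') (p : ℕ), 0 < cJ P p)
  (h613 : ∀ {N d M₁ D M p r : ℕ}, p.Prime → r.Prime → p ≠ r → D = d * (p * r) →
    M₁ = p * r * M → IsAdmissibleFactorization N D M →
    ∀ (X₁ : ShimuraCurveData d M₁) (X₂ : ShimuraCurveData D M)
      (W : WeierstrassCurve ℚ) [W.IsElliptic] [W.IsGloballyMinimal], W.conductorNorm ℤ = N →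
    ∀ (W₁' : WeierstrassCurve ℚ) [W₁'.IsElliptic] (P₁ : ShimuraParametrizationData X₁ W₁'),
      P₁.IsMinimalFor W →
    ∀ (W₂' : WeierstrassCurve ℚ) [W₂'.IsElliptic] (P₂ : ShimuraParametrizationData X₂ W₂'),
      P₂.IsMinimalFor W →
      P₁.deg * (cI P₁ p ^ 2 * cJ P₂ r ^ 2) =
        P₂.deg * ((W₁'.minimalDiscriminantNorm ℤ).factorization p *
          (W₂'.minimalDiscriminantNorm ℤ).factorization r))
  (hJc : ∀ {N D M : ℕ}, IsAdmissibleFactorization N D M →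
    ∀ (X : ShimuraCurveData D M) (W : WeierstrassCurve ℚ) [W.IsElliptic] [W.IsGloballyMinimal],
      W.conductorNorm ℤ = N →
    ∀ (W' : WeierstrassCurve ℚ) [W'.IsElliptic] (P : ShimuraParametrizationData X W'),
      P.IsMinimalFor W → ∀ p : ℕ, p.Prime → p ∣ D →
      cJ P p ∣ (W'.minimalDiscriminantNorm ℤ).factorization p)
  (hEis : ∀ {N D M : ℕ}, IsAdmissibleFactorization N D M →
    ∀ (X : ShimuraCurveData D M) (W : WeierstrassCurve ℚ) [W.IsElliptic] [W.IsGloballyMinimal],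
      W.conductorNorm ℤ = N →
    ∀ (W' : WeierstrassCurve ℚ) [W'.IsElliptic] (P : ShimuraParametrizationData X W'),
      P.IsMinimalFor W → ∀ p : ℕ, p.Prime → p ∣ M → ¬ p ^ 2 ∣ M →
      ∀ r : ℕ, r.Prime → ¬ r ∣ N → (cI P p : ℤ) ∣ (r + 1 : ℤ) - W'.LFunction r)
  (h618 : ∀ {N D M : ℕ}, IsAdmissibleFactorization N D M →
    ∀ (X : ShimuraCurveData D M) (W : WeierstrassCurve ℚ) [W.IsElliptic] [W.IsGloballyMinimal],
      W.conductorNorm ℤ = N →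
    ∀ (W' : WeierstrassCurve ℚ) [W'.IsElliptic] (P : ShimuraParametrizationData X W'),
      P.IsMinimalFor W → ∀ p : ℕ, p.Prime → p ∣ D → cJ P p ∣ p - 1)
  (hwit : ∀ (W : WeierstrassCurve ℚ) [W.IsElliptic], W.HasIrreducibleModPGaloisRep 3 →
    ∀ r₀ : ℕ, ∃ r : ℕ, r₀ < r ∧ r.Prime ∧ ¬ (3 : ℤ) ∣ (r + 1 : ℤ) - W.LFunction r)

/-! ## §5. R5a: `QuaternionicTamagawaTransferAtThreeKnownCase` from the inputs -/

include hI hJ h613 hJc hEis h618 hwit in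
/-- **R5a = `QuaternionicTamagawaTransferAtThreeKnownCase` is a THEOREM-CHAIN over the
Ribet–Takahashi inputs at `ℓ = 3`.** From the Jacquet–Langlands existence fact `hP`, the
component-group data with Prop. 6.13 (`h613`), `j_p ∣ c_p(A_{D,M})` (`hJc`), Ribet's Eisenstein
divisibility (`hEis`), Lemma 6.18 (`h618`), an irreducibility witness (`hwit`) and the `3`-adic
`D = 1` bridge (`h0'`): `QuaternionicTamagawaTransferAtThreeKnownCase` — for every admissible
`N = D M` having a prime `q₀ ∣ D` with `q₀ ≢ 1 (mod 3)`, or with `3 ∤ v_{q₀}(Δ_E)` for the curves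
`E` of conductor `N`, `γ_{D,M,E}` is a `3`-adic unit whenever `E[3]` is irreducible. Lemma 6.8 is
used in its EXACT form at `3` (a theorem here, from irreducibility: §1), Lemma 6.15 in its exact form
(§3), and the telescoping keeps the witness prime in `D` to the last pair (§4). 0 named facts.
[cite: PastenShimura2024, Thm. 6.1 and §6.9 p. 25, Prop. 6.13 p. 23, Lemmas 6.14–6.15 pp. 23–24, Lemma 6.18 p. 25] [cite: RibetTakahashi1997, Thm. 2] -/
theorem quaternionicTamagawaTransferAtThreeKnownCase_of_ribetTakahashi_inputs
    (hP : nonempty_shimuraParametrizationData)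
    (h0' : ∀ {N : ℕ} [NeZero N] (X : ShimuraCurveData 1 N) (W : WeierstrassCurve ℚ) [W.IsElliptic]
      [W.IsGloballyMinimal], W.conductorNorm ℤ = N → W.HasIrreducibleModPGaloisRep 3 →
      ∀ (W₁ : WeierstrassCurve ℚ) [W₁.IsElliptic] (D₁ : ModularParametrizationData W₁ N),
        IsNewformOf W D₁.f →
        (∀ (W₂ : WeierstrassCurve ℚ) [W₂.IsElliptic] (D₂ : ModularParametrizationData W₂ N),
            D₂.f = D₁.f → D₁.modularDegree ≤ D₂.modularDegree) →
      ∀ (W' : WeierstrassCurve ℚ) [W'.IsElliptic] (P : ShimuraParametrizationData X W'),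
        P.IsMinimalFor W → ∃ a b : ℕ, 0 < a ∧ 0 < b ∧ ¬ 3 ∣ a ∧ ¬ 3 ∣ b ∧
          D₁.modularDegree * b = a * P.deg) :
    QuaternionicTamagawaTransferAtThreeKnownCase := by
  intro N D M _ hadm hcase X W _ _ hWN hirr W₁ _ D₁ hf hmin W' _ P hPmin
  -- the witness prime for `W`
  have hwD : D = 1 ∨ ∃ q₀ ∈ D.primeFactors,
      (q₀ % 3 ≠ 1 ∨ ¬ 3 ∣ (W.minimalDiscriminantNorm ℤ).factorization q₀) := by
    rcases hcase with ⟨q₀, hq, hmod⟩ | hall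
    · exact Or.inr ⟨q₀, hq, Or.inl hmod⟩
    · obtain ⟨q₀, hq, hc⟩ := hall W hWN
      exact Or.inr ⟨q₀, hq, Or.inr hc⟩
  obtain ⟨n, hn⟩ := hadm.even_card_primeFactors
  obtain ⟨a, b, ha, hb, ha3, hb3, e⟩ :=
    modularDegree_mul_eq_mul_coprime_of_witness cI cJ hI hJ h613 hJc hEis h618 hwit Nat.prime_three hP
      h0' n hadm (by omega) X W hWN hirr hwD W₁ D₁ hf hmin W' P hPmin
  exact ⟨a, b, ha, hb, ha3, hb3, e⟩

end RTSystemAtThree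

end Summit.BirchSwinnertonDyer.Rank1Residual.AdditiveThree

end
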